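import Literature.AlgebraicGeometry.Resolution.EmbeddedResolution
import Literature.AlgebraicGeometry.Resolution.PrincipalizationToResolution
import Literature.AlgebraicGeometry.Resolution.BlowupsProperProofs
import Mathlib.AlgebraicGeometry.Morphisms.ClosedImmersion
import Mathlib.AlgebraicGeometry.Noetherian
import HarnessLib

/-!
# BGMW 2011 §3.3 (2) ⇒ (3): the strict transform is smooth once it lies on a centre

Topic: `Literature/AlgebraicGeometry/Resolution`. PROVED lemmas for the decomposition of the
named fact `BierstoneGrigorievMilmanWlodarczyk2011_embedded` (`EmbeddedResolution.lean`;
Bierstone–Grigoriev–Milman–Włodarczyk 2011, Cor. 8.0.6 of the arXiv version: canonical embedded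
resolution of singularities of `Y ⊂ 𝔸ⁿ` over a perfect field of characteristic
`p > M(d, n, l)`), following the printed proof (BGMW §3.3, "Hironaka resolution principle"):

  (1) canonical resolution of the marked ideal `(𝔸ⁿ, 𝓘_Y, ∅, 1)` (Thm. 8.0.5 with
      Lemma 8.0.3 (1), (4) and the Galois-descent Remark, p. 23) ⇒
  (2) canonical principalization of `𝓘_Y` ⇒
  (3) weak embedded desingularization of `Y` (Thm. 2.0.2): "in the course of the
      principalization of `𝓘_Y`, the strict transform `Y_i` of `Y` in some `X_i` is the center
      of a blow-up. At this stage `Y_i` is nonsingular" (p. 7).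

This file PROVES the last sentence over Mathlib in the rendering of `EmbeddedResolution.lean`
(regular for smooth, strict transform as a closed set with its reduced structure): if, after a
sequence of blow-ups `σ : X' → X` with regular centres lying over `T ∌ ξ` (`IsEmbeddedTransform
(closure {ξ}) T σ Y'`, `Y = closure {ξ}` irreducible), a further regular centre `V(C) ⊆ X'` lies
over `Y` and passes through the point `ξ'` over `ξ`, then the strict transform `Y' = closure {ξ'}`
is, near `ξ'` (over the open `V ⊇ X ∖ T` over which `σ` is an isomorphism), equal to `V(C)`;
being irreducible it is the closure of an open subset of the regular scheme `V(C)`, hence open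
and closed in it, hence regular with its reduced structure
(`IsEmbeddedTransform.isRegular_subscheme_of_centre`). The layer below — that the canonical
resolution of `(𝔸ⁿ, 𝓘_Y, ∅, 1)` exists in characteristic `p > M(d, n, l)` and is functorial
under open immersions, which is what makes its centres avoid `Reg(Y)` until one of them
swallows the strict transform — is the subject of `CanonicalResolution.lean` (named fact
`BierstoneGrigorievMilmanWlodarczyk2011_canonical` over the data-level multiple blow-ups of
`BlowupSequences.lean`), which closes `BierstoneGrigorievMilmanWlodarczyk2011_embedded` from it
with the lemma proved here. (No "centre form" of Cor. 8.0.6 is vendored: the statement "an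
embedded transform over `X ∖ Reg(Y)` followed by a regular centre over `Y` through the point
over the generic point" is logically equivalent to `BierstoneGrigorievMilmanWlodarczyk2011_embedded`
— the converse takes `C` = the vanishing ideal of the strict transform — so it would only
restate that fact.)

## Content (namespace `Literature.AlgGeom`)

* `Scheme.IsRegular.isOpen_closure_of_isNoetherian`, `Scheme.IsRegular.isOpen_closure` — in a
  (locally) Noetherian regular scheme the closure of an open subset is open (irreducible
  components of a regular scheme are pairwise disjoint, hence open; Stacks 0357 for normal
  schemes) [folklore].
* `ker_eq_vanishingIdeal_of_isReduced` — the kernel (ideal sheaf) of a morphism from a reduced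
  scheme is the vanishing ideal sheaf of the closure of its image [folklore].
* `Scheme.IsRegular.subscheme_vanishingIdeal_closure` — for a closed immersion `g : S ↪ X` of a
  locally Noetherian regular scheme and an open `W ⊆ X`, the reduced closed subscheme of `X` on
  `closure (g(S) ∩ W)` is regular (it is isomorphic to the open-and-closed piece
  `closure (g⁻¹ W)` of `S`, by uniqueness of reduced closed subscheme structures, Mathlib
  `IsClosedImmersion.isIso_lift`) [folklore].
* `IsEmbeddedTransform.isRegular_subscheme_of_centre` — BGMW §3.3 (2) ⇒ (3), last sentence,
  PROVED (see above).

## Sources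

* E. Bierstone, D. Grigoriev, P. Milman, J. Włodarczyk, *Effective Hironaka resolution and its
  complexity (with appendix on applications in positive characteristic)*, Asian J. Math. 15
  (2011) 193–228 = arXiv:1206.3090 (arXiv numbering and pages): Thm. 2.0.2 (p. 5), Def. 3.1.3
  and §3.3 (pp. 6–7), Lemma 8.0.3, Thms. 8.0.4–8.0.5, Remark and Cor. 8.0.6 (p. 23).
  [BierstoneGrigorievMilmanWlodarczyk2011]
* The Stacks Project, Tag 0357 (irreducible components of normal schemes are disjoint),
  Tag 02IS (regular schemes). [StacksProject]
-/

noncomputable section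

open CategoryTheory CategoryTheory.Limits AlgebraicGeometry TopologicalSpace Topology

namespace Literature.AlgebraicGeometry.Resolution

universe u

/-! ## Regular schemes: the closure of an open subset is open -/

section RegularClopen

variable {S : Scheme.{u}}

/-- In a Noetherian regular scheme the closure of an open subset `W` is open: the irreducible
component through a point `z ∈ closure W` is open (components of a regular scheme are pairwise
disjoint, `Scheme.IsRegular.coe_irreducibleComponentOpen`), meets `W`, and is therefore contained
in `closure W`. (Stacks, Tag 0357 for normal schemes.) [folklore] -/
theorem Scheme.IsRegular.isOpen_closure_of_isNoetherian [IsNoetherian S]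
    (hS : Scheme.IsRegular S) {W : Set S} (hW : IsOpen W) : IsOpen (closure W) := by
  rw [isOpen_iff_forall_mem_open]
  intro z hz
  have hC := irreducibleComponent_mem_irreducibleComponents z
  have hopen : IsOpen (irreducibleComponent z) := by
    rw [← hS.coe_irreducibleComponentOpen hC]
    exact (S.irreducibleComponentOpen _).isOpen
  refine ⟨irreducibleComponent z, ?_, hopen, mem_irreducibleComponent⟩
  have hne : (irreducibleComponent z ∩ W).Nonempty :=
    mem_closure_iff.mp hz _ hopen mem_irreducibleComponent
  calc irreducibleComponent z ⊆ closure (irreducibleComponent z ∩ W) :=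
        subset_closure_inter_of_isPreirreducible_of_isOpen
          isIrreducible_irreducibleComponent.isPreirreducible hW hne
    _ ⊆ closure W := closure_mono Set.inter_subset_right

/-- In a locally Noetherian regular scheme the closure of an open subset is open (reduce to a
Noetherian affine open neighbourhood of each point of the closure). [folklore] -/
theorem Scheme.IsRegular.isOpen_closure [IsLocallyNoetherian S] (hS : Scheme.IsRegular S)
    {W : Set S} (hW : IsOpen W) : IsOpen (closure W) := by
  rw [isOpen_iff_forall_mem_open]
  intro z hz
  obtain ⟨A, hA, hzA, -⟩ :=
    exists_isAffineOpen_mem_and_subset (X := S) (x := z) (U := ⊤) (Opens.mem_top z)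
  haveI : CompactSpace A := isCompact_iff_compactSpace.mp hA.isCompact
  haveI : IsNoetherian (A : Scheme.{u}) := {}
  have hAreg : Scheme.IsRegular (A : Scheme.{u}) := hS.of_isOpenImmersion A.ι
  have hemb := A.ι.isOpenEmbedding
  have hzA' : (⟨z, hzA⟩ : A) ∈ closure (A.ι ⁻¹' W) := by
    rw [← hemb.isOpenMap.preimage_closure_eq_closure_preimage A.ι.continuous]
    exact hz
  have hO := hAreg.isOpen_closure_of_isNoetherian (hW.preimage A.ι.continuous)
  refine ⟨A.ι '' closure (A.ι ⁻¹' W), ?_, hemb.isOpenMap _ hO, ⟨⟨z, hzA⟩, hzA', rfl⟩⟩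
  calc A.ι '' closure (A.ι ⁻¹' W)
      ⊆ closure (A.ι '' (A.ι ⁻¹' W)) := image_closure_subset_closure_image A.ι.continuous
    _ ⊆ closure W := closure_mono (Set.image_preimage_subset _ _)

end RegularClopen

/-! ## Reduced closed subschemes on closures of open pieces of regular closed subschemes -/

section ReducedPiece

open Scheme.IdealSheafData

variable {S X : Scheme.{u}}

/-- The kernel of a morphism `j : S → X` from a reduced scheme is the vanishing ideal sheaf of the
closure of its image (`ker j = j_*(nil S) = j_*(𝓘(S)) = 𝓘(closure (j(S)))`). [folklore] -/
theorem ker_eq_vanishingIdeal_of_isReduced [IsReduced S] (j : S ⟶ X) :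
    j.ker = vanishingIdeal (.closure (Set.range j)) := by
  have h1 : j.ker = (vanishingIdeal (⊤ : Closeds S)).map j := by
    rw [vanishingIdeal_top, Scheme.nilradical_eq_bot, map_bot]
  rw [h1, map_vanishingIdeal]
  congr 1
  ext x
  simp [Set.image_univ]

/-- **Closures of open pieces of a regular closed subscheme are regular.** Let `g : S ↪ X` be a
closed immersion of a locally Noetherian regular scheme and `W ⊆ X` open. Then the reduced closed
subscheme of `X` on `closure (g(S) ∩ W)` is regular: `closure (g⁻¹ W)` is open and closed in
`S` (`Scheme.IsRegular.isOpen_closure`), so it is a regular, reduced scheme embedded in `X` as a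
closed subscheme with underlying set `closure (g(S) ∩ W)`, and reduced closed subschemes with
the same support are isomorphic (Mathlib `IsClosedImmersion.isIso_lift`). [folklore] -/
theorem Scheme.IsRegular.subscheme_vanishingIdeal_closure [IsLocallyNoetherian S]
    (hS : Scheme.IsRegular S) (g : S ⟶ X) [IsClosedImmersion g] (W : X.Opens) :
    Scheme.IsRegular (vanishingIdeal
      (⟨closure (Set.range g ∩ (W : Set X)), isClosed_closure⟩ : Closeds X)).subscheme := by
  -- the open-and-closed piece `V = closure (g⁻¹ W)` of `S`
  let V : S.Opens :=
    ⟨closure ((g ⁻¹ᵁ W : S.Opens) : Set S), hS.isOpen_closure (g ⁻¹ᵁ W).isOpen⟩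
  have hVreg : Scheme.IsRegular (V : Scheme.{u}) := hS.of_isOpenImmersion V.ι
  haveI : IsReduced (V : Scheme.{u}) := hVreg.isReduced
  haveI : IsClosedImmersion V.ι :=
    IsClosedImmersion.of_isPreimmersion V.ι (by rw [Scheme.Opens.range_ι]; exact isClosed_closure)
  set j : (V : Scheme.{u}) ⟶ X := V.ι ≫ g with hj
  -- embedded in `X` as a closed subscheme with underlying set `closure (g(S) ∩ W)`
  have hrange : Set.range j = closure (Set.range g ∩ (W : Set X)) := by
    rw [hj, Scheme.Hom.comp_base, TopCat.coe_comp, Set.range_comp, Scheme.Opens.range_ι]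
    change g '' closure (g ⁻¹' (W : Set X)) = _
    rw [← g.isClosedEmbedding.closure_image_eq, Set.image_preimage_eq_range_inter]
  have hker : (vanishingIdeal (⟨closure (Set.range g ∩ (W : Set X)), isClosed_closure⟩ :
      Closeds X)).subschemeι.ker = j.ker := by
    rw [ker_subschemeι, ker_eq_vanishingIdeal_of_isReduced]
    congr 1
    ext x
    change x ∈ closure (Set.range g ∩ (W : Set X)) ↔ x ∈ closure (Set.range j)
    rw [hrange, closure_closure]
  -- reduced closed subschemes with the same support are isomorphic
  haveI := IsClosedImmersion.isIso_lift _ j hker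
  exact hVreg.of_iso (IsClosedImmersion.lift _ j hker.le)

end ReducedPiece

/-! ## BGMW §3.3 (2) ⇒ (3): the strict transform is regular once a regular centre contains it -/

namespace IsEmbeddedTransform

variable {X : Scheme.{u}} {T : Set X}

/-- **BGMW 2011, §3.3 (2) ⇒ (3), last sentence** ("in the course of the principalization of
`𝓘_Y`, the strict transform `Y_i` of `Y` in some `X_i` is the center of a blow-up. At this stage
`Y_i` is nonsingular"), over Mathlib, in the rendering of `EmbeddedResolution.lean`. Let `X` be
locally Noetherian, `Y = closure {ξ}` irreducible with `ξ ∉ T`, `σ : X' → X` a sequence of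
blow-ups with regular centres over `T` and `Y' ⊆ X'` the iterated strict transform of `Y`
(`IsEmbeddedTransform`). If a further regular centre `V(C) ⊆ X'` lies over `Y` and passes
through a point over `ξ`, then the reduced closed subscheme of `X'` on `Y'` is regular. Proof:
`σ` is an isomorphism over an open `V ⊇ X ∖ T ∋ ξ` and `Y' = closure {ξ'}` for the unique `ξ'`
over `ξ` (`isProper_and_exists`, blow-ups being proper, `stacks02NS_holds`); over `V` both
`V(C)` and `Y'` coincide with `σ⁻¹(Y)`, so `Y'` is the closure of the open piece
`V(C) ∩ σ⁻¹ V` of the regular scheme `V(C)` (`Scheme.IsRegular.subscheme_vanishingIdeal_closure`).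
[cite: BierstoneGrigorievMilmanWlodarczyk2011, §3.3 (2)⇒(3), p. 7] -/
theorem isRegular_subscheme_of_centre [IsLocallyNoetherian X] {ξ : X} (hξ : ξ ∉ T)
    {X' : Scheme.{u}} {σ : X' ⟶ X} {Y' : Set X'}
    (h : IsEmbeddedTransform (closure {ξ}) T σ Y') (C : X'.IdealSheafData)
    (hC : Scheme.IsRegular C.subscheme) (hCY : σ '' (C.support : Set X') ⊆ closure {ξ})
    (hξC : ξ ∈ σ '' (C.support : Set X')) :
    Scheme.IsRegular (Scheme.IdealSheafData.vanishingIdeal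
      (⟨closure Y', isClosed_closure⟩ : Closeds X')).subscheme := by
  obtain ⟨hσ, V, hTV, hiso, ξ', hξ', hY'⟩ := h.isProper_and_exists stacks02NS_holds hξ
  haveI : IsLocallyNoetherian X' := LocallyOfFiniteType.isLocallyNoetherian σ
  haveI : IsLocallyNoetherian C.subscheme :=
    LocallyOfFiniteType.isLocallyNoetherian C.subschemeι
  have hξV : ξ ∈ V := hTV hξ
  -- the fibre of `σ` over `ξ` is `{ξ'}`
  have hfib : σ ⁻¹' {ξ} = {ξ'} := by
    obtain ⟨x, -, huniq⟩ := existsUnique_preimage_of_isIso_morphismRestrict σ hiso hξV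
    ext z
    simp only [Set.mem_preimage, Set.mem_singleton_iff]
    exact ⟨fun hz => (huniq z hz).trans (huniq ξ' hξ').symm, fun hz => hz ▸ hξ'⟩
  -- so `ξ'` lies on the centre
  have hξ'C : ξ' ∈ (C.support : Set X') := by
    obtain ⟨x, hxC, hx⟩ := hξC
    have hx' : x ∈ σ ⁻¹' {ξ} := hx
    rw [hfib, Set.mem_singleton_iff] at hx'
    exact hx' ▸ hxC
  -- over `V`, the centre coincides with the strict transform `closure {ξ'}`
  let W : X'.Opens := σ ⁻¹ᵁ V
  have hCW : (C.support : Set X') ∩ (W : Set X') = closure {ξ'} ∩ (W : Set X') := by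
    apply le_antisymm
    · rintro x ⟨hxC, hxW⟩
      refine ⟨?_, hxW⟩
      have hx : σ x ∈ closure {ξ} := hCY ⟨x, hxC, rfl⟩
      have := preimage_closure_inter_subset_of_isIso_morphismRestrict σ hiso {ξ} ⟨hx, hxW⟩
      rwa [hfib] at this
    · rintro x ⟨hx, hxW⟩
      exact ⟨closure_minimal (Set.singleton_subset_iff.mpr hξ'C) C.support.isClosed hx, hxW⟩
  have hcl : closure ((C.support : Set X') ∩ (W : Set X')) = closure Y' := by
    rw [hCW, hY', closure_closure]
    apply le_antisymm
    · exact closure_minimal Set.inter_subset_left isClosed_closure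
    · refine closure_mono (Set.singleton_subset_iff.mpr ⟨subset_closure rfl, ?_⟩)
      show σ ξ' ∈ V
      rw [hξ']
      exact hξV
  -- the strict transform is the closure of an open piece of the regular scheme `V(C)`
  have key := hC.subscheme_vanishingIdeal_closure C.subschemeι W
  have e : (⟨closure (Set.range C.subschemeι ∩ (W : Set X')), isClosed_closure⟩ : Closeds X') =
      ⟨closure Y', isClosed_closure⟩ := by
    apply Closeds.ext
    change closure (Set.range C.subschemeι ∩ (W : Set X')) = closure Y'
    rw [Scheme.IdealSheafData.range_subschemeι, hcl]
  rwa [e] at key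

end IsEmbeddedTransform

end Literature.AlgebraicGeometry.Resolution
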